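import Literature.Barriers.AnomalousDissipation.ShearFlowViscositySelection
import HarnessLib

/-!
# Bardos–Titi–Wiedemann 2012, Thm. 5 — the Lagrangian side of the barrier: the selected shear
flow is free streaming along straight particle paths (barrier audit, gen 5, of
`ShearFlowViscositySelectionSteps`)

Companion to `Literature/Barriers/AnomalousDissipation/ShearFlowViscositySelection.lean`, whose
barrier block `BardosTitiWiedemann2012_thm5` (Bardos–Titi–Wiedemann, C. R. Math. 350 (2012),
Thm. 5; proved in the tree, `BardosTitiWiedemann2012_thm5_holds`) records, as block (ii), that the
vanishing-viscosity limit of shear data is rough yet conserves energy, so that Eulerian roughness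
of a viscosity limit does not imply anomalous dissipation. This file isolates the structural
reason in Lagrangian terms, for ALL measurable profiles `v₁ : T → ℝ`, `v₃ : T² → ℝ`:

* `freeStream v₀ t` — ballistic transport `x ↦ x + t v₀(x)` on `T³` (componentwise mod `1`).
* `shearFlow_freeStream` — **the shear flow is free streaming**: with `v₀ = shearData v₁ v₃` and
  `X_t = freeStream v₀ t`, `v(X_t(x), t) = v₀(x)` for every `x` and `t`: each fluid particle moves
  on the straight line `t ↦ x + t v₀(x)` at its initial velocity (the shear flow solves Euler
  with zero pressure, Bardos–Titi–Wiedemann 2012, §2 (4); DiPerna–Majda 1987).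
* `freeStream_shearData_eq_comp` — `X_t` is the composite of two skew translations of `T³`
  (along `e₀` by `t v₁(x₂)`, along `e₂` by `t v₃(x₁,x₂)`), hence
* `measurePreserving_freeStream_shearData` — **`X_t` preserves Lebesgue measure** (it is an
  incompressible Lagrangian flow map) for all measurable `v₁, v₃`, via the general
  `measurePreserving_add_piSingle` (a translation along one coordinate axis by an amount depending
  measurably on the other coordinates preserves Haar measure: Mathlib's
  `MeasurePreserving.skew_product` transported through `MeasurableEquiv.piFinSuccAbove`);
* `freeStream_shearData_bijective` — `X_t` is a bijection of `T³` (particles never collide);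
* `lintegral_comp_freeStream_shearData` — change of variables along `X_t`, and
  `lintegral_enorm_sq_shearFlow_freeStream` — `∫|v(X_t x, t)|² dx = ∫|v₀|²`; together they give
  the Lagrangian proof of energy conservation (Bardos–Titi 2010, Thm. 2 (ii)), whose statement is
  the tree's `shearFlow_lintegral_enorm_sq` (Eulerian Fubini proof; not restated).

Reading for the barrier (block (ii) of `BardosTitiWiedemann2012_thm5`): the witnesses are
Eulerian-rough (generic `v₁, v₃ ∈ L²` lie in no Onsager class) but Lagrangian-laminar — an explicit
measure-preserving flow by straight lines, no stretching, no splitting of trajectories. Since the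
Navier–Stokes solutions of the shear class are pressureless as well (op. cit., proof of Thm. 5),
the Navier–Stokes fluctuation–dissipation relation of Drivas–Eyink (J. Fluid Mech. 829 (2017),
§5: `ν∫₀ᵗ⟨|∇u|²⟩ = ½⟨Var[u₀(ξ̃_{t,0}) − ∫₀ᵗ∇p(ξ̃_{t,s},s)ds]⟩`) loses its pressure term there and
coincides with the scalar relation of op. cit. §2, for which "anomalous scalar dissipation and
Lagrangian spontaneous stochasticity are … equivalent" (op. cit. §4): inside the shear class,
absence of anomalous ENERGY dissipation is equivalent to asymptotic determinism of the backward
stochastic Lagrangian trajectories sampled on `v₀`. The inference the barrier blocks is therefore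
"Eulerian roughness ⇒ anomaly"; Lagrangian formulations ("spontaneous stochasticity / positive
pair dispersion in the limit ⇒ anomaly") are not touched by it (recorded in the `scope_caveats` of
the barrier block by the same audit).

## References

* C. Bardos, E. S. Titi, E. Wiedemann, C. R. Math. Acad. Sci. Paris 350 (2012) 757–760, §2 (4),
  Thm. 5 and its proof (`BardosTitiWiedemann2012`).
* C. Bardos, E. S. Titi, Discrete Contin. Dyn. Syst. Ser. S 3 (2010) 185–197, Thm. 2 (ii),
  Lemma 3 (`BardosTiti2010`).
* T. D. Drivas, G. L. Eyink, J. Fluid Mech. 829 (2017) 153–189 = arXiv:1606.00729, §2 (FDR),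
  §4 (equivalence with spontaneous stochasticity, with and without sources), §5 (the
  Navier–Stokes relation and its pressure obstruction) (`DrivasEyink2017`).
* R. J. DiPerna, A. J. Majda, Comm. Math. Phys. 108 (1987) 667–689 (`DiPernaMajda1987`).
-/

open MeasureTheory Set Filter Topology Function
open scoped ENNReal NNReal

noncomputable section

namespace Literature.Barriers.AnomalousDissipation

/-- The flat three-torus `T³ = (ℝ/ℤ)³` (local notation). -/
local notation "𝕋³" => UnitAddTorus (Fin 3)
/-- Velocity values (local notation). -/
local notation "E³" => EuclideanSpace ℝ (Fin 3)

/-! ## Skew translations of `T³` preserve Haar measure -/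

/-- **Skew translations preserve Lebesgue measure on `T³`.** If `g : T³ → T` is measurable and
does not depend on the `i`-th coordinate, then `x ↦ x + g(x)·eᵢ` preserves `volume`: split off
the `i`-th coordinate (`MeasurableEquiv.piFinSuccAbove`, measure preserving), where the map becomes
the skew product `(a, r) ↦ (a + g̃(r), r)` over the identity of `T²`, measure preserving by
translation invariance of Haar measure on the circle in the fibre
(`MeasurePreserving.skew_product`, `measurePreserving_add_right`). The tree's
`measurePreserving_skewTranslate` (`ShearFlowViscositySelectionModalTransport`) is the case `i = 0`
in `![·]`-form; here any axis, in `Pi.single`-form, as needed for the third coordinate. [folklore] -/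
theorem measurePreserving_add_piSingle (i : Fin 3) {g : 𝕋³ → UnitAddCircle} (hg : Measurable g)
    (hgi : ∀ (x : 𝕋³) (s : UnitAddCircle), g (x + Pi.single i s) = g x) :
    MeasurePreserving (fun x : 𝕋³ => x + Pi.single i (g x)) volume volume := by
  set e := MeasurableEquiv.piFinSuccAbove (fun _ : Fin 3 => UnitAddCircle) i with he_def
  have he : MeasurePreserving e (volume : Measure 𝕋³)
      ((volume : Measure UnitAddCircle).prod (volume : Measure (Fin 2 → UnitAddCircle))) :=
    volume_preserving_piFinSuccAbove (fun _ : Fin 3 => UnitAddCircle) i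
  have he' : MeasurePreserving e.symm
      ((volume : Measure UnitAddCircle).prod (volume : Measure (Fin 2 → UnitAddCircle)))
      (volume : Measure 𝕋³) := he.symm
  -- coordinates of `e` and `e.symm`
  have he_fst : ∀ x : 𝕋³, (e x).1 = x i := fun x => by simp [he_def]
  have he_snd : ∀ (x : 𝕋³) (k : Fin 2), (e x).2 k = x (i.succAbove k) := fun x k => by
    simp [he_def, Fin.removeNth]
  have hes_same : ∀ (a : UnitAddCircle) (r : Fin 2 → UnitAddCircle), e.symm (a, r) i = a :=
    fun a r => by simp [he_def]
  have hes_succ : ∀ (a : UnitAddCircle) (r : Fin 2 → UnitAddCircle) (k : Fin 2),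
      e.symm (a, r) (i.succAbove k) = r k := fun a r k => by simp [he_def]
  -- inserting `a` at slot `i` is inserting `0` and translating along `eᵢ`
  have hins : ∀ (a : UnitAddCircle) (r : Fin 2 → UnitAddCircle),
      e.symm (a, r) = e.symm (0, r) + Pi.single i a := by
    intro a r
    funext j
    rcases Fin.eq_self_or_eq_succAbove i j with rfl | ⟨k, rfl⟩
    · rw [Pi.add_apply, hes_same, hes_same, Pi.single_eq_same, zero_add]
    · rw [Pi.add_apply, hes_succ, hes_succ, Pi.single_eq_of_ne (Fin.succAbove_ne i k), add_zero]
  -- the amount of translation as a function of the remaining coordinates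
  set g' : (Fin 2 → UnitAddCircle) → UnitAddCircle := fun r => g (e.symm (0, r)) with hg'_def
  have hg'm : Measurable g' :=
    hg.comp (e.symm.measurable.comp (measurable_const.prodMk measurable_id))
  have hg_e : ∀ x : 𝕋³, g x = g' (e x).2 := by
    intro x
    calc g x = g (e.symm (e x)) := by rw [e.symm_apply_apply]
      _ = g (e.symm ((e x).1, (e x).2)) := rfl
      _ = g (e.symm (0, (e x).2) + Pi.single i (e x).1) := by rw [hins]
      _ = g' (e x).2 := hgi _ _
  -- the skew product on `T² × T`, then swapped to `T × T²`
  have hΨ : MeasurePreserving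
      (fun q : (Fin 2 → UnitAddCircle) × UnitAddCircle => (id q.1, q.2 + g' q.1))
      ((volume : Measure (Fin 2 → UnitAddCircle)).prod (volume : Measure UnitAddCircle))
      ((volume : Measure (Fin 2 → UnitAddCircle)).prod (volume : Measure UnitAddCircle)) := by
    refine (MeasurePreserving.id _).skew_product (g := fun r a => a + g' r) ?_ ?_
    · exact measurable_snd.add (hg'm.comp measurable_fst)
    · exact ae_of_all _ fun r => (measurePreserving_add_right volume (g' r)).map_eq
  set Φ : UnitAddCircle × (Fin 2 → UnitAddCircle) → UnitAddCircle × (Fin 2 → UnitAddCircle) :=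
    fun p => (p.1 + g' p.2, p.2) with hΦ_def
  have hΦ : MeasurePreserving Φ
      ((volume : Measure UnitAddCircle).prod (volume : Measure (Fin 2 → UnitAddCircle)))
      ((volume : Measure UnitAddCircle).prod (volume : Measure (Fin 2 → UnitAddCircle))) := by
    have hsw₁ : MeasurePreserving (Prod.swap : UnitAddCircle × (Fin 2 → UnitAddCircle) → _)
        ((volume : Measure UnitAddCircle).prod (volume : Measure (Fin 2 → UnitAddCircle)))
        ((volume : Measure (Fin 2 → UnitAddCircle)).prod (volume : Measure UnitAddCircle)) :=
      Measure.measurePreserving_swap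
    have hsw₂ : MeasurePreserving (Prod.swap : (Fin 2 → UnitAddCircle) × UnitAddCircle → _)
        ((volume : Measure (Fin 2 → UnitAddCircle)).prod (volume : Measure UnitAddCircle))
        ((volume : Measure UnitAddCircle).prod (volume : Measure (Fin 2 → UnitAddCircle))) :=
      Measure.measurePreserving_swap
    have hfun : Φ = Prod.swap ∘ (fun q : (Fin 2 → UnitAddCircle) × UnitAddCircle =>
        (id q.1, q.2 + g' q.1)) ∘ Prod.swap := by
      funext p; rfl
    rw [hfun]
    exact hsw₂.comp (hΨ.comp hsw₁)
  -- transport back to `T³`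
  have hfun : (fun x : 𝕋³ => x + Pi.single i (g x)) = e.symm ∘ Φ ∘ e := by
    funext x
    have h1 : e.symm (Φ (e x)) = e.symm (0, (e x).2) + Pi.single i ((e x).1 + g' (e x).2) := by
      rw [← hins]
    have h2 : x = e.symm (0, (e x).2) + Pi.single i (e x).1 := by
      conv_lhs => rw [← e.symm_apply_apply x]
      rw [← hins]
    simp only [Function.comp_apply]
    rw [h1, hg_e x, Pi.single_add, ← add_assoc, ← h2]
  rw [hfun]
  exact he'.comp (hΦ.comp he)

/-! ## Free streaming, and the shear flow as ballistic transport of its datum -/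

/-- **Free streaming (ballistic transport) on `T³`** with velocity datum `v₀`: the map
`X_t(x) = x + t v₀(x)` (componentwise modulo `1`), i.e. every point moves on the straight line
through `x` with constant velocity `v₀(x)` (the Lagrangian flow of pressureless, collisionless
motion). [folklore] -/
def freeStream (v₀ : 𝕋³ → E³) (t : ℝ) (x : 𝕋³) : 𝕋³ :=
  fun i => x i + ((t * v₀ x i : ℝ) : UnitAddCircle)

/-- At `t = 0` free streaming is the identity. [folklore] -/
theorem freeStream_zero (v₀ : 𝕋³ → E³) : freeStream v₀ 0 = id := by
  funext x; funext i; simp [freeStream]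

variable (v₁ : UnitAddCircle → ℝ) (v₃ : UnitAddTorus (Fin 2) → ℝ)

/-- The components of free streaming with shear datum: `x₁ ↦ x₁ + t v₁(x₂)`, `x₂ ↦ x₂`,
`x₃ ↦ x₃ + t v₃(x₁,x₂)` (indices `0,1,2`). [folklore] -/
theorem freeStream_shearData_apply (t : ℝ) (x : 𝕋³) :
    freeStream (shearData v₁ v₃) t x 0 = x 0 + ((t * v₁ (x 1) : ℝ) : UnitAddCircle) ∧
      freeStream (shearData v₁ v₃) t x 1 = x 1 ∧
      freeStream (shearData v₁ v₃) t x 2 = x 2 + ((t * v₃ ![x 0, x 1] : ℝ) : UnitAddCircle) := by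
  simp [freeStream, shearData]

/-- **The shear flow is free streaming of its datum** (Bardos–Titi–Wiedemann 2012, §2 (4);
DiPerna–Majda 1987): for ALL `v₁ : T → ℝ`, `v₃ : T² → ℝ`, every `t` and every `x ∈ T³`,
`v(X_t(x), t) = v₀(x)` with `v = shearFlow v₁ v₃`, `v₀ = shearData v₁ v₃`, `X_t = freeStream v₀ t`:
the velocity is constant along each straight particle path `t ↦ x + t v₀(x)`, which is therefore
an integral curve of `v` — the shear flow is the pressureless Euler flow transporting every
particle ballistically, however rough `v₁, v₃` are. [cite: BardosTitiWiedemann2012, §2 (4)] -/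
theorem shearFlow_freeStream (t : ℝ) (x : 𝕋³) :
    shearFlow v₁ v₃ t (freeStream (shearData v₁ v₃) t x) = shearData v₁ v₃ x := by
  obtain ⟨h0, h1, -⟩ := freeStream_shearData_apply v₁ v₃ t x
  have h : shearFlow v₁ v₃ t (freeStream (shearData v₁ v₃) t x) =
      !₂[v₁ (freeStream (shearData v₁ v₃) t x 1), 0,
        v₃ ![freeStream (shearData v₁ v₃) t x 0 -
              ((t * v₁ (freeStream (shearData v₁ v₃) t x 1) : ℝ) : UnitAddCircle),
            freeStream (shearData v₁ v₃) t x 1]] := rfl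
  rw [h, h1, h0, add_sub_cancel_right]
  rfl

/-- **Free streaming with shear datum is a composite of two skew translations**: first along
`e₀` by `t v₁(x₂)`, then along `e₂` by `t v₃(y₁ - t v₁(y₂), y₂)` (which, after the first step,
is `t v₃(x₁, x₂)`). [folklore] -/
theorem freeStream_shearData_eq_comp (t : ℝ) :
    freeStream (shearData v₁ v₃) t =
      (fun y : 𝕋³ => y + Pi.single (2 : Fin 3)
          (((t * v₃ ![y 0 - ((t * v₁ (y 1) : ℝ) : UnitAddCircle), y 1] : ℝ) : UnitAddCircle))) ∘
        (fun x : 𝕋³ => x + Pi.single (0 : Fin 3) (((t * v₁ (x 1) : ℝ) : UnitAddCircle))) := by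
  funext x
  obtain ⟨h0, h1, h2⟩ := freeStream_shearData_apply v₁ v₃ t x
  funext j
  fin_cases j
  · simp [h0]
  · simp [h1]
  · simp [h2, add_sub_cancel_right]

variable {v₁ v₃}

/-- **The free-streaming map of shear data preserves Lebesgue measure on `T³`** (it is an
incompressible Lagrangian flow map), for all measurable `v₁, v₃` and every `t`: both skew
translations of `freeStream_shearData_eq_comp` do (`measurePreserving_add_piSingle`). This is the
Lagrangian content of Bardos–Titi 2010, Lemma 3. [cite: BardosTiti2010, Lemma 3] -/
theorem measurePreserving_freeStream_shearData (hv₁ : Measurable v₁) (hv₃ : Measurable v₃)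
    (t : ℝ) : MeasurePreserving (freeStream (shearData v₁ v₃) t) volume volume := by
  have hmk : Measurable (fun y : ℝ => (y : UnitAddCircle)) := AddCircle.measurable_mk'
  have hφ : Measurable fun x : 𝕋³ => (((t * v₁ (x 1) : ℝ) : UnitAddCircle)) :=
    hmk.comp (measurable_const.mul (hv₁.comp (measurable_pi_apply 1)))
  have hvec : Measurable fun y : 𝕋³ =>
      (![y 0 - ((t * v₁ (y 1) : ℝ) : UnitAddCircle), y 1] : UnitAddTorus (Fin 2)) := by
    refine measurable_pi_lambda _ fun j => ?_
    fin_cases j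
    · exact (measurable_pi_apply 0).sub hφ
    · exact measurable_pi_apply 1
  have hψ : Measurable fun y : 𝕋³ =>
      (((t * v₃ ![y 0 - ((t * v₁ (y 1) : ℝ) : UnitAddCircle), y 1] : ℝ) : UnitAddCircle)) :=
    hmk.comp (measurable_const.mul (hv₃.comp hvec))
  have h₀ := measurePreserving_add_piSingle 0 hφ fun x s => by simp
  have h₂ := measurePreserving_add_piSingle 2 hψ fun x s => by simp
  rw [freeStream_shearData_eq_comp]
  exact h₂.comp h₀

/-- Free streaming with shear datum is injective (distinct particles never collide: the map is
triangular in the coordinates `x₂, x₁, x₃`). [folklore] -/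
theorem freeStream_shearData_injective (t : ℝ) : Injective (freeStream (shearData v₁ v₃) t) := by
  intro x y hxy
  obtain ⟨hx0, hx1, hx2⟩ := freeStream_shearData_apply v₁ v₃ t x
  obtain ⟨hy0, hy1, hy2⟩ := freeStream_shearData_apply v₁ v₃ t y
  have h1 : x 1 = y 1 := by rw [← hx1, ← hy1, hxy]
  have h0 : x 0 = y 0 := by
    have h := congrFun hxy 0
    rw [hx0, hy0, h1] at h
    exact add_right_cancel h
  have h2 : x 2 = y 2 := by
    have h := congrFun hxy 2
    rw [hx2, hy2, h0, h1] at h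
    exact add_right_cancel h
  funext j
  fin_cases j
  · exact h0
  · exact h1
  · exact h2

/-- Free streaming with shear datum is surjective (explicit preimage
`(y₁ - t v₁(y₂), y₂, y₃ - t v₃(y₁ - t v₁(y₂), y₂))`), hence a bijection of `T³`. [folklore] -/
theorem freeStream_shearData_bijective (t : ℝ) : Bijective (freeStream (shearData v₁ v₃) t) := by
  refine ⟨freeStream_shearData_injective t, fun y => ?_⟩
  set a : UnitAddCircle := y 0 - ((t * v₁ (y 1) : ℝ) : UnitAddCircle) with ha
  refine ⟨![a, y 1, y 2 - ((t * v₃ ![a, y 1] : ℝ) : UnitAddCircle)], ?_⟩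
  obtain ⟨h0, h1, h2⟩ := freeStream_shearData_apply v₁ v₃ t
    ![a, y 1, y 2 - ((t * v₃ ![a, y 1] : ℝ) : UnitAddCircle)]
  funext j
  fin_cases j
  · simp only [Fin.zero_eta] at h0 ⊢
    rw [h0]; simp [ha]
  · simp only [Fin.mk_one] at h1 ⊢
    rw [h1]; simp
  · simp only [Fin.reduceFinMk] at h2 ⊢
    rw [h2]; simp

/-- **Change of variables along the flow**: for measurable `v₁, v₃` and every measurable
`F : T³ → [0,∞]`, `∫ F(X_t(x)) dx = ∫ F(y) dy`. [folklore] -/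
theorem lintegral_comp_freeStream_shearData (hv₁ : Measurable v₁) (hv₃ : Measurable v₃) (t : ℝ)
    {F : 𝕋³ → ℝ≥0∞} (hF : Measurable F) :
    ∫⁻ x, F (freeStream (shearData v₁ v₃) t x) = ∫⁻ y, F y :=
  (measurePreserving_freeStream_shearData hv₁ hv₃ t).lintegral_comp hF

/-- **Energy along the flow**: `∫|v(X_t x, t)|² dx = ∫|v₀(x)|² dx` for all `v₁, v₃` and every `t`
— the velocity is constant along particle paths (`shearFlow_freeStream`), pointwise, so no
measurability is needed. Combined with the change of variables `lintegral_comp_freeStream_shearData`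
(for measurable profiles) this is the Lagrangian proof of energy conservation of the shear flow,
Bardos–Titi 2010, Thm. 2 (ii) — the statement itself is the tree's `shearFlow_lintegral_enorm_sq`
(Eulerian Fubini proof) and is not restated here. [cite: BardosTiti2010, Thm. 2 (ii)] -/
theorem lintegral_enorm_sq_shearFlow_freeStream (t : ℝ) :
    ∫⁻ x, ‖shearFlow v₁ v₃ t (freeStream (shearData v₁ v₃) t x)‖ₑ ^ 2 =
      ∫⁻ x, ‖shearData v₁ v₃ x‖ₑ ^ 2 := by
  refine lintegral_congr fun x => ?_
  rw [shearFlow_freeStream]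

end Literature.Barriers.AnomalousDissipation

end
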